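import Literature.AlgebraicGeometry.Frobenioids.PerfFactorial
import Literature.AlgebraicGeometry.Frobenioids.PerfectionDivisorial
import Literature.AlgebraicGeometry.Frobenioids.PerfectionPrimes
import Literature.AlgebraicGeometry.Frobenioids.Factorization
import Literature.AlgebraicGeometry.Frobenioids.FactorizationTransport
import HarnessLib

/-!
# Frobenioids I, Def. 2.4 (i): "`M^pf` is also perf-factorial" (proof), and the standing facts

Mochizuki, *The geometry of Frobenioids I*, Kyushu J. Math. **62** (2008), §2, Definition 2.4 (i),
kurims pp. 47–48 [cite: MochizukiFrdI2008, Def. 2.4(i) p.48].  Proof-only companion of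
`PerfFactorial.lean` (abc-iut node `FrdI:Def2.4(i)`, closing claims):

* `PerfectionIsPerfFactorial_holds` — "Finally, one verifies immediately that `M^pf` … [is] also
  perf-factorial" (p. 48): (a) the perfection of a divisorial monoid is divisorial
  (`PerfectionDivisorial.lean`); (b) `((M^pf)^pf)`-primes aside, every `(M^pf)_𝔮 ≅ (M_𝔭)^pf` is
  monoprime (`PerfectionPrimes.lean`); (c), (d) transport along the §0 isomorphism
  `M^pf ≅ (M^pf)^pf` of the perfect monoid `M^pf` (`FactorizationTransport.lean`).
* For a perf-factorial `M`: every `M^rlf_𝔮` is `ℝ`-monoprime, so the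
  supremum defining the `𝔮`-component of the factorization map exists and is characterised by
  "bounded by `b` iff `b ≥` the component" with no extra hypothesis (`IsPerfFactorial.factorMap_spec`).

No statement of the paper is strengthened.
-/

noncomputable section

namespace Literature.AlgebraicGeometry.Frobenioids

open Function

universe u

variable {M : Type u} [CommMonoid M]

namespace IsPerfFactorial

/-- For perf-factorial `M`, every `M^rlf_𝔮 = M^pf_𝔮 ⊗ ℝ_{≥0}` is `ℝ`-monoprime (every
`M^pf_𝔮 ≅ (M_𝔭)^pf` is monoprime: `isMonoprime_submonoid_primes_perfection`, also landed as
`EtaleTheta.PerfectionPrimes.isMonoprime_pfAt`). [cite: MochizukiFrdI2008, Def. 2.4(i) p.47] -/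
theorem isRMonoprime_rlfAt (h : IsPerfFactorial M) (𝔮 : Primes (Perfection M)) :
    IsRMonoprime (RlfAt M 𝔮) :=
  isRMonoprime_realification_submonoid_primes_perfection h.isDivisorial.isSharp h.isMonoprime 𝔮

/-- For perf-factorial `M` the supremum `sup Bound_{𝔮 ∪ {0}}(a) ∈ M^rlf_𝔮` exists: there is an `s`
with "`Bound_{𝔮 ∪ {0}}(a)` bounded by `b` iff `b ≥ s`" (§0 p. 12 in the `ℝ`-monoprime `M^rlf_𝔮`).
[cite: MochizukiFrdI2008, Def. 2.4(i) p.47] -/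
theorem exists_isSup_boundAt (h : IsPerfFactorial M) (𝔮 : Primes (Perfection M)) (a : Perfection M) :
    ∃ s : RlfAt M 𝔮, ∀ b, IsBoundedBy (boundAt M 𝔮 a) b ↔ s ∣ b := by
  obtain ⟨b₀, hb₀⟩ := h.bounded 𝔮 a
  exact (existsUnique_sup_of_isRMonoprime (h.isRMonoprime_rlfAt 𝔮) _ b₀ hb₀).exists

/-- For perf-factorial `M`: "`Bound_{𝔮 ∪ {0}}(a)` is bounded by `b` iff `b ≥` the `𝔮`-component of
the factorization of `a`" — `factorMap_spec` of `PerfFactorial.lean` with its hypotheses discharged.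
[cite: MochizukiFrdI2008, Def. 2.4(i) p.47] -/
theorem factorMap_spec (h : IsPerfFactorial M) {𝔮 : Primes (Perfection M)} {a : Perfection M}
    (b : RlfAt M 𝔮) : IsBoundedBy (boundAt M 𝔮 a) b ↔ factorMap M a 𝔮 ∣ b :=
  divSup_spec (h.exists_isSup_boundAt 𝔮 a) b

/-- For perf-factorial `M`: if `x ∈ 𝔮 ∪ {0}` divides `a` in `M^pf` then `x ⊗ 1 ≤` the `𝔮`-component
of the factorization of `a`. [cite: MochizukiFrdI2008, Def. 2.4(i) p.47] -/
theorem of_dvd_factorMap (h : IsPerfFactorial M) {𝔮 : Primes (Perfection M)} {a : Perfection M}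
    (x : PfAt M 𝔮) (hx : x.1 ∈ 𝔮.carrier ∨ x.1 = 1) (hxa : x.1 ∣ a) :
    Realification.of (PfAt M 𝔮) x ∣ factorMap M a 𝔮 :=
  ((h.factorMap_spec (factorMap M a 𝔮)).mpr dvd_rfl) _ ⟨x, hx, hxa, rfl⟩

/-- For perf-factorial `M`, the `𝔮`-component of the factorization of `a` is bounded by `b` as soon
as every `x ⊗ 1`, `x ∈ 𝔮 ∪ {0}`, `x ≤ a`, is. [cite: MochizukiFrdI2008, Def. 2.4(i) p.47] -/
theorem factorMap_dvd_of_isBoundedBy (h : IsPerfFactorial M) {𝔮 : Primes (Perfection M)}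
    {a : Perfection M} {b : RlfAt M 𝔮} (hb : IsBoundedBy (boundAt M 𝔮 a) b) : factorMap M a 𝔮 ∣ b :=
  (h.factorMap_spec b).mp hb

end IsPerfFactorial

/-- **Definition 2.4 (i), p. 48: "Finally, one verifies immediately that `M^pf` … [is] also
perf-factorial"** — the named statement `PerfectionIsPerfFactorial M` of `PerfFactorial.lean`,
discharged: (a) `M^pf` is divisorial; (b) every `(M^pf)_𝔮 ≅ (M_𝔭)^pf` is monoprime; (c), (d) are
transported along the isomorphism `M^pf ≅ (M^pf)^pf` (§0 p. 11, `M^pf` perfect).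
[cite: MochizukiFrdI2008, Def. 2.4(i) p.48] -/
theorem PerfectionIsPerfFactorial_holds : PerfectionIsPerfFactorial M := fun h =>
  IsPerfFactorial.of_cond h.isDivisorial.perfection
    (isMonoprime_submonoid_primes_perfection h.isDivisorial.isSharp h.isMonoprime)
    (Factorization.Cond.of_mulEquiv (isPerfect_perfection (M := M)).equivPerfection h.cond)

end Literature.AlgebraicGeometry.Frobenioids
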